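import Summits.BirchSwinnertonDyer.BirchSwinnertonDyer.Theorems.AlignedTransportAtTwoMainConjectureOfRankZeroBSDAtTwoFineRoadKleinCountingInfinite
import Summits.BirchSwinnertonDyer.BirchSwinnertonDyer.Theorems.AlignedTransportAtTwoMainConjectureOfRankZeroBSDAtTwoFineRoadKleinCountingS3Exact
import HarnessLib

/-!
# Route `AlignedTransportAtTwo`, crux C2 `MainConjectureOfRankZeroBSDAtTwo` (stmt-BirchSwinnertonDyer-22298),
# road (b″): PERFECT DESCENT at `2`, part XIV — the counting lemma AT A FINITE LAYER without `2`-torsion: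
# for a FINITE abelian group `C` with an `S₃`-action, `#Hom_{S₃}(C, V₄)² = #Hom_σ(C, V₄) = #(W/2W)`, `W = ker(1 + σ + σ²)`

Cell `bsd-f1-sign2`, WIDTH-5 attach seat `bsd-line-att-p3` (gen 5) on line `birth` of crux C2
(`--supports` stmt-BirchSwinnertonDyer-22298; closes nothing). HONEST FRAMING: THEOREMS ONLY — no definition, no
named fact, no instance, no `sorry`; BSD is NOT proved by any of this. Parts VI–VIII (att-p3 g4) counted
`Hom_Q(V, V₄)` for a finite `Q`-module `V` KILLED BY `2` (`#Hom_{S₃}(V, V₄)² = #((1 − e₁)V)`); part IX removed the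
`2`-torsion hypothesis in bijection form (`Hom_σ(X, V₄) ≃ (W →+ ℤ/2)`). This file closes the loop at a finite layer:
for ANY finite abelian group `C` with a `Q`-action through `Aut(V₄) ≅ S₃` — the intended `C` is (the `2`-part of) the
class group `Cl(F_n)` of the `n`-th layer of `F = ℚ(E[2])` with its `Gal(F_n/ℚ_n) ≅ S₃`-action, the tree's currency for
Iwasawa's `μ` being the growth of `#Cl(F_n)[2^∞]` (`classNumberPExp`, `classGroupPRank`, Fukuda's criterion) — the count
reads `#Hom_{S₃}(C, V₄)² = #(W/2W) = 2^{rank₂ W}`, `W = ker(1 + σ + σ²) ⊆ C` the norm-minus part («χ-part»).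

## What is proved

* §1 **`natCard_addMonoidHom_zmodTwo_eq_natCard_quotient`**: for a FINITE abelian group `U`,
  `#(U →+ ℤ/2) = #(U ⧸ 2U)` (every map to `ℤ/2` factors through `U/2U`, an `𝔽₂`-space self-dual in size —
  part VI `natCard_addMonoidHom_of_two_torsion`).
* §2 **`natCard_sigmaEquivariant_eq_natCard_quotient`**: `C` finite abelian with a `Q`-action, `σ ∈ Q` fixed-point-free
  on `V₄` with `σ³ = 1` on `C`: `#Hom_σ(C, V₄) = #(W ⧸ 2W)`, `W = ker(1 + σ + σ²) ≤ C` (part IX's bijection + §1).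
* §3 **`natCard_equivariant_sq_eq_natCard_quotient_S3`** (`Q̄ = S₃`): `#Hom_Q(C, V₄)² = #(W ⧸ 2W)` (part VIII's
  `#Hom_σ = #Hom_{σ,τ}²`); **`natCard_equivariant_eq_natCard_quotient_of_no_transposition`** (`Q̄ = C₃`):
  `#Hom_Q(C, V₄) = #(W ⧸ 2W)`. So along the layers `C_n`, `dim_{𝔽₂} Hom_{S₃}(C_n, V₄) = ½·rank₂(W_n)`: bounded iff
  `rank₂ W_n` is bounded — by Fukuda 1994 Thm 1 (2) / the structure theory, iff `μ((1 − e₁)X) = 0` (the Λ-adic parts X–XIII).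

Not here: the Galois action on `ClassGroup (𝓞 F_n)` and the CFT reading `Hom(Cl(F_n), E[2]) = H¹_nr(F_n, E[2])` (typing).

References: J.-P. Serre, *Linear Representations of Finite Groups*, §2.6; T. Fukuda, Proc. Japan Acad. 70 (1994) Thm 1;
PERFECT-DESCENT.md §3 (iii) (lead att-p2 g4).
-/

set_option autoImplicit false
-- the Theorems namespace of this sub repeats the summit name by design (D-0017 nested layout)
set_option linter.dupNamespace false

noncomputable section

namespace Summit.BirchSwinnertonDyer.BirchSwinnertonDyer.Theorems.AlignedTransportAtTwoFineRoad.PerfectDescent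

open Summit.BirchSwinnertonDyer.BirchSwinnertonDyer.Theorems.MultTransportAtTwo
open Pointwise

/-! ## §1 `#Hom(U, ℤ/2) = #(U/2U)` for a finite abelian group `U` -/

section DualCount

variable {U : Type*} [AddCommGroup U]

/-- **`#(U →+ ℤ/2) = #(U ⧸ 2U)`** for a finite abelian group `U` (`2U = 2 • ⊤` as a `ℤ`-submodule): additive maps
`U → ℤ/2` are the additive maps `U/2U → ℤ/2` (they kill `2U`), and `U/2U` has exponent `2`, so there are `#(U/2U)` of
them (part VI `natCard_addMonoidHom_of_two_torsion`). [cite: SerreGaloisCohomology1997, I §5.1] -/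
theorem natCard_addMonoidHom_zmodTwo_eq_natCard_quotient [Finite U] :
    Nat.card (U →+ ZMod 2) = Nat.card (U ⧸ ((2 : ℤ) • (⊤ : Submodule ℤ U))) := by
  set N : Submodule ℤ U := (2 : ℤ) • (⊤ : Submodule ℤ U) with hN
  have hz2 : ∀ c : ZMod 2, (2 : ℤ) • c = 0 := by decide
  -- every `ℤ`-linear map to `ℤ/2` kills `N`
  have hle : ∀ f : U →ₗ[ℤ] ZMod 2, N ≤ LinearMap.ker f := by
    intro f x hx
    obtain ⟨b, -, rfl⟩ := (Submodule.mem_smul_pointwise_iff_exists x (2 : ℤ) ⊤).mp hx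
    rw [LinearMap.mem_ker, map_smul, hz2]
  -- `(U →ₗ[ℤ] ℤ/2) ≃ (U/N →ₗ[ℤ] ℤ/2)`
  let e : (U →ₗ[ℤ] ZMod 2) ≃ (U ⧸ N →ₗ[ℤ] ZMod 2) :=
    { toFun := fun f ↦ N.liftQ f (hle f)
      invFun := fun g ↦ g.comp N.mkQ
      left_inv := fun f ↦ Submodule.liftQ_mkQ N f (hle f)
      right_inv := fun g ↦ Submodule.linearMap_qext N (Submodule.liftQ_mkQ N _ _) }
  have hN2 : ∀ x : U ⧸ N, x + x = 0 := by
    intro x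
    obtain ⟨u, rfl⟩ := N.mkQ_surjective x
    rw [← map_add, Submodule.mkQ_apply, Submodule.Quotient.mk_eq_zero, ← two_smul ℤ]
    exact Submodule.smul_mem_pointwise_smul u (2 : ℤ) ⊤ Submodule.mem_top
  have hA2 : ∀ a : ZMod 2, a + a = 0 := by decide
  have hA : Nat.card (ZMod 2) = 2 := by rw [Nat.card_eq_fintype_card, ZMod.card]
  calc Nat.card (U →+ ZMod 2) = Nat.card (U →ₗ[ℤ] ZMod 2) := Nat.card_congr (addMonoidHomLequivInt ℤ).toEquiv
    _ = Nat.card (U ⧸ N →ₗ[ℤ] ZMod 2) := Nat.card_congr e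
    _ = Nat.card (U ⧸ N →+ ZMod 2) := (Nat.card_congr (addMonoidHomLequivInt ℤ).toEquiv).symm
    _ = Nat.card (U ⧸ N) := natCard_addMonoidHom_of_two_torsion hN2 hA2 hA

end DualCount

/-! ## §2 `#Hom_σ(C, V₄) = #(W/2W)` for a finite abelian group `C` -/

section Layer

variable {Q : Type*} [Group Q] {M : Type*} [AddCommGroup M] [DistribMulAction Q M]
  {C : Type*} [AddCommGroup C] [DistribMulAction Q C]

/-- Membership in `W = ker(1 + σ + σ²)`, as an additive subgroup of `C`. [folklore] -/
theorem mem_ker_one_add_sigma_add_sigma_sq_addMonoidHom_iff (σ : Q) (x : C) :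
    x ∈ (AddMonoidHom.id C + DistribSMul.toAddMonoidHom C σ +
        (DistribSMul.toAddMonoidHom C σ).comp (DistribSMul.toAddMonoidHom C σ)).ker ↔
      x + σ • x + σ • (σ • x) = 0 := by
  simp [AddMonoidHom.mem_ker]

/-- **Counting at a finite layer, `σ`-form: `#Hom_σ(C, V₄) = #(W ⧸ 2W)`** for a FINITE abelian group `C` with a
`Q`-action, `σ ∈ Q` fixed-point-free on the Klein four-group `M` and `σ³ = 1` on `C`, `W = ker(1 + σ + σ²) ≤ C`. No
hypothesis `x + x = 0`: `C` may be any finite abelian group (e.g. a class group with an `S₃`-action); part VI's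
`natCard_sigmaEquivariant_eq` is the case `2C = 0`. [cite: SerreGaloisCohomology1997, I §5.1] -/
theorem natCard_sigmaEquivariant_eq_natCard_quotient [Finite C] (h4 : Nat.card M = 4) (h2 : ∀ m : M, m + m = 0)
    {σ : Q} (hσ : ∀ m : M, σ • m = m → m = 0) (hσ3 : ∀ x : C, σ • (σ • (σ • x)) = x) :
    Nat.card {f : C →+ M // ∀ x : C, f (σ • x) = σ • f x} =
      Nat.card (↥(AddMonoidHom.id C + DistribSMul.toAddMonoidHom C σ +
          (DistribSMul.toAddMonoidHom C σ).comp (DistribSMul.toAddMonoidHom C σ)).ker ⧸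
        ((2 : ℤ) • (⊤ : Submodule ℤ ↥(AddMonoidHom.id C + DistribSMul.toAddMonoidHom C σ +
          (DistribSMul.toAddMonoidHom C σ).comp (DistribSMul.toAddMonoidHom C σ)).ker))) := by
  set W := (AddMonoidHom.id C + DistribSMul.toAddMonoidHom C σ +
    (DistribSMul.toAddMonoidHom C σ).comp (DistribSMul.toAddMonoidHom C σ)).ker with hWdef
  have hW : ∀ w : C, w ∈ W → w + σ • w + σ • (σ • w) = 0 := fun w hw ↦
    (mem_ker_one_add_sigma_add_sigma_sq_addMonoidHom_iff σ w).mp hw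
  have hF : ∀ x : C, x + x - σ • x - σ • (σ • x) ∈ W := fun x ↦
    (mem_ker_one_add_sigma_add_sigma_sq_addMonoidHom_iff σ _).mpr (by
      simp only [smul_add, smul_sub, hσ3]
      abel)
  rw [natCard_sigmaEquivariant_eq_natCard_addMonoidHom h4 h2 hσ hσ3 W hW hF]
  exact natCard_addMonoidHom_zmodTwo_eq_natCard_quotient

/-- **Counting at a finite layer, `Q̄ = S₃`: `#Hom_Q(C, V₄)² = #(W ⧸ 2W)`.** `Q` acts on the Klein four-group `M` through
`Aut(M) ≅ S₃` (`σ` fixed-point-free, `τ ≠ 1` fixing `m₀ ≠ 0`) and additively on the FINITE abelian group `C`, the kernel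
of the action on `M` acting trivially on `C`; `W = ker(1 + σ + σ²)`. Then `#Hom_Q(C, V₄)² = #(W/2W)`, i.e.
`dim_{𝔽₂} Hom_{S₃}(C, V₄) = ½ · rank₂(W)` (part VIII `#Hom_σ = #Hom_{σ,τ}²` + `natCard_sigmaEquivariant_eq_natCard_quotient`).
For `C = Cl(F_n)` along the cyclotomic tower of `F = ℚ(E[2])`: the `S₃`-equivariant maps to `E[2]` are counted by the
`2`-rank of the norm-minus part of the class group. [cite: SerreGaloisCohomology1997, I §5.1] -/
theorem natCard_equivariant_sq_eq_natCard_quotient_S3 [Finite C] (h4 : Nat.card M = 4) (h2 : ∀ m : M, m + m = 0)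
    {σ τ : Q} {m₀ : M} (hσ : ∀ m : M, σ • m = m → m = 0) (hm₀ : m₀ ≠ 0) (hτ0 : τ • m₀ = m₀)
    (hτ : ¬ ∀ m : M, τ • m = m) (hVN : ∀ g : Q, (∀ m : M, g • m = m) → ∀ x : C, g • x = x) :
    Nat.card {f : C →+ M // ∀ (g : Q) (x : C), f (g • x) = g • f x} ^ 2 =
      Nat.card (↥(AddMonoidHom.id C + DistribSMul.toAddMonoidHom C σ +
          (DistribSMul.toAddMonoidHom C σ).comp (DistribSMul.toAddMonoidHom C σ)).ker ⧸
        ((2 : ℤ) • (⊤ : Submodule ℤ ↥(AddMonoidHom.id C + DistribSMul.toAddMonoidHom C σ +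
          (DistribSMul.toAddMonoidHom C σ).comp (DistribSMul.toAddMonoidHom C σ)).ker))) := by
  have e : Nat.card {f : C →+ M // ∀ (g : Q) (x : C), f (g • x) = g • f x} =
      Nat.card {f : C →+ M // (∀ x : C, f (σ • x) = σ • f x) ∧ ∀ x : C, f (τ • x) = τ • f x} :=
    Nat.card_congr (Equiv.subtypeEquivRight fun f ↦ equivariant_iff_sigma_tau h4 h2 hσ hm₀ hτ0 hτ hVN f)
  rw [e, ← natCard_sigmaEquivariant_eq_sq h4 h2 hσ hm₀ hτ0 hτ hVN,
    natCard_sigmaEquivariant_eq_natCard_quotient h4 h2 hσ (smul_smul_smul_eq_self_of_kernel h4 h2 hσ hVN)]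

/-- **Counting at a finite layer, `Q̄ = C₃`: `#Hom_Q(C, V₄) = #(W ⧸ 2W)`** (no element of `Q` acts on `M` as a
transposition; `Hom_Q = Hom_σ` by part VI). [cite: SerreGaloisCohomology1997, I §5.1] -/
theorem natCard_equivariant_eq_natCard_quotient_of_no_transposition [Finite C] (h4 : Nat.card M = 4)
    (h2 : ∀ m : M, m + m = 0) {σ : Q} (hσ : ∀ m : M, σ • m = m → m = 0)
    (hnoT : ∀ g : Q, (∀ m : M, g • m = m) ∨ (∀ m : M, g • m = m → m = 0))
    (hVN : ∀ g : Q, (∀ m : M, g • m = m) → ∀ x : C, g • x = x) :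
    Nat.card {f : C →+ M // ∀ (g : Q) (x : C), f (g • x) = g • f x} =
      Nat.card (↥(AddMonoidHom.id C + DistribSMul.toAddMonoidHom C σ +
          (DistribSMul.toAddMonoidHom C σ).comp (DistribSMul.toAddMonoidHom C σ)).ker ⧸
        ((2 : ℤ) • (⊤ : Submodule ℤ ↥(AddMonoidHom.id C + DistribSMul.toAddMonoidHom C σ +
          (DistribSMul.toAddMonoidHom C σ).comp (DistribSMul.toAddMonoidHom C σ)).ker))) := by
  rw [← natCard_sigmaEquivariant_eq_natCard_quotient h4 h2 hσ (smul_smul_smul_eq_self_of_kernel h4 h2 hσ hVN)]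
  exact Nat.card_congr (Equiv.subtypeEquivRight fun f ↦
    ⟨fun h x ↦ h σ x, fun h g x ↦ equivariant_of_sigmaEquivariant_of_no_transposition h4 h2 hσ hnoT hVN f h g x⟩)

end Layer

end Summit.BirchSwinnertonDyer.BirchSwinnertonDyer.Theorems.AlignedTransportAtTwoFineRoad.PerfectDescent

end
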